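import Literature.NumberTheory.Transcendental.BakerQuantDelta
import Literature.NumberTheory.Transcendental.BakerLogarithmsAuxiliary
import Mathlib.Analysis.Calculus.Deriv.Polynomial
import Mathlib.Analysis.Calculus.IteratedDeriv.Lemmas
import HarnessLib

/-!
# Baker 1975, Ch. 3 — the set-up and the auxiliary function of Theorem 3.1 (Lemmas 4–5)

Support for the proof of Theorem 3.1 of A. Baker, *Transcendental Number Theory* (1975), Ch. 3
(`Literature.NumberTheory.Transcendental.baker1975_thm_3_1`); sequel to `BakerQuantDelta.lean`.

Baker (§3, p. 32) fixes non-zero algebraic `α₁, …, αₙ` with given logarithms, supposes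
`|β₀ + β₁ log α₁ + ⋯ + β_{n-1} log α_{n-1} - log αₙ| < B^{-C}` (1) and works with the auxiliary
function (Lemma 4)
`Φ(z₀, …, z_{n-1}) = ∑ p(λ₋₁, …, λₙ) (Δ(z₀ + λ₋₁; h))^{λ₀+1} e^{λₙ β₀ z₀} α₁^{γ₁ z₁} ⋯ α_{n-1}^{γ_{n-1} z_{n-1}}`,
`γᵣ = λᵣ + λₙ βᵣ`, and its diagonal derivatives `f(z) = Φ_{m₀,…,m_{n-1}}(z, …, z)` (Lemma 5).

This file provides (everything proved):

* `Setup` — the FIXED data: `n + 1` non-zero logarithms `lᵢ` of algebraic numbers (Baker's `n`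
  logarithms are our `n + 1`; the last one, `l (Fin.last n)`, is the one with coefficient `-1` in
  (1)) and the degree bound `D₀` for the coefficient fields; with the constant `Λ = 1 + ∑ |lᵢ|`.
* `Data S` — the VARYING data of one instance of (1): a number field `K ⊆ ℂ` of degree `≤ D₀`
  containing the `αᵢ = e^{lᵢ}`, the coefficients `β₀, β₁, …` in `K`, and the size parameter `h`
  (think `h ≍ log B`) controlling their denominators and conjugates (`≤ eʰ`); `Data.Λ'` is the
  small linear form `β₀ + ∑ βᵣ lᵣ - lₙ` of (1).
* `Qw m w b z = ∑_μ binom(m, μ) w^{(μ)}(z) b^{m-μ}` — the Leibniz polynomial, with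
  `(d/dz)^m (w(z) e^{bz}) = Qw · e^{bz}` (`iteratedDeriv_eval_mul_cexp`); this is Baker's
  `q(λ₋₁, λ₀, λₙ, z) = ∑ binom(m₀,μ₀) μ₀! Δ(z + λ₋₁; h, λ₀+1, μ₀) (λₙβ₀)^{m₀-μ₀}` (p. 32) for
  `w = ` the `z₀`-polynomial.
* the closed form of `f`: `Data.term`, `Data.F p m z = ∑_u p(u) · Qw(m₀, w_u, λₙβ₀, z) ·
  ∏ᵣ (γᵣ lᵣ)^{mᵣ} · e^{(ψ_u + λₙ Λ') z}` over the index set `Idx` of `u = (λ₋₁, λ₀, λ₁, …)`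
  (`λ₋₁ < h`, `0 ≤ λ₀, λᵢ ≤ L`), where `ψ_u = ∑ λᵢ lᵢ`; here the `z₀`-polynomial is the triangular
  variant `w_u = Δ(z; λ₋₁) Δ(z; h)^{λ₀}` of `BakerQuantDelta.wPoly` (same arithmetic and growth as
  Baker's `Δ(z + λ₋₁; h)^{λ₀+1}`), and the identity `λₙβ₀ + ∑ γᵣ lᵣ = ψ_u + λₙ Λ'` replaces the
  substitution of `αₙ'` for `αₙ` (p. 33);
* `Data.hasDerivAt_F` — `(d/dz) F_m = ∑ᵢ F_{m + eᵢ}` (the chain rule behind `f_m`, p. 23/35),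
  `Data.norm_iteratedDeriv_F_le_of_forall` — derivatives are controlled by values;
* `Data.norm_F_le` — **Lemma 5, first assertion**: `|f(z)| ≤ c^{hk + L|z|}` in the explicit form
  `#Idx · P · m₀! · 4^{(⌈|z|⌉+h)(L+1)} (2 L eʰ Λ)^{|m|} e^{L(Λ+1)|z|}` when `|p(u)| ≤ P`, `|Λ'| ≤ 1`.

## References

* A. Baker, *Transcendental Number Theory*, Cambridge Univ. Press 1975, Ch. 3 §3, Lemmas 4–5
  (pp. 32–34). [BakerTNT1975]
-/

noncomputable section

open Complex Finset Polynomial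

namespace Literature.NumberTheory.Transcendental.Baker1975.Ch3

/-! ### The Leibniz polynomial `Qw` -/

/-- **The Leibniz polynomial** `Qw m w b z = ∑_{μ ≤ m} binom(m, μ) · w^{(μ)}(z) · b^{m-μ}`, so that
`(d/dz)^m (w(z) e^{bz}) = Qw(m, w, b, z) e^{bz}`; for `w` the `z₀`-polynomial this is Baker's
`q(λ₋₁, λ₀, λₙ, z)` (p. 32, with `w^{(μ)} = μ! Δ(⋯, μ)`). [cite: BakerTNT1975, Ch. 3 §3 Lemma 4] -/
def Qw (m : ℕ) (w : ℂ[X]) (b z : ℂ) : ℂ :=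
  ∑ μ ∈ range (m + 1), (m.choose μ : ℂ) * (derivative^[μ] w).eval z * b ^ (m - μ)

/-- `Qw 0 w b z = w(z)`. [folklore] -/
@[simp] theorem Qw_zero (w : ℂ[X]) (b z : ℂ) : Qw 0 w b z = w.eval z := by
  simp [Qw]

/-- The iterated derivatives of a polynomial function are the iterated formal derivatives.
[folklore] -/
theorem iteratedDeriv_polynomial_eval (w : ℂ[X]) (k : ℕ) :
    iteratedDeriv k (fun z => w.eval z) = fun z => (derivative^[k] w).eval z := by
  induction k generalizing w with
  | zero => simp
  | succ k ih =>
    rw [iteratedDeriv_succ', Function.iterate_succ_apply]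
    have : deriv (fun z => w.eval z) = fun z => w.derivative.eval z := by
      funext z; exact w.deriv
    rw [this, ih]

/-- **Leibniz**: `(d/dz)^m (w(z) e^{bz}) = Qw(m, w, b, z) · e^{bz}`. [folklore] -/
theorem iteratedDeriv_eval_mul_cexp (w : ℂ[X]) (b : ℂ) (m : ℕ) (z : ℂ) :
    iteratedDeriv m (fun x => w.eval x * cexp (b * x)) z = Qw m w b z * cexp (b * z) := by
  have hf : ContDiffAt ℂ m (fun x : ℂ => w.eval x) z := w.differentiable.contDiff.contDiffAt
  have hg : ContDiffAt ℂ m (fun x : ℂ => cexp (b * x)) z := by fun_prop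
  have hfg : (fun x => w.eval x * cexp (b * x)) = (fun x : ℂ => w.eval x) * fun x : ℂ => cexp (b * x) :=
    rfl
  rw [hfg, iteratedDeriv_mul hf hg]
  simp only [iteratedDeriv_polynomial_eval, iteratedDeriv_cexp_const_mul]
  unfold Qw
  rw [sum_mul]
  refine sum_congr rfl fun μ _ => ?_
  ring

/-- The function `z ↦ Qw m w b z · e^{bz}` is the `m`-th derivative of `w(z) e^{bz}`, hence its
derivative is `Qw (m+1) w b z · e^{bz}`. [folklore] -/
theorem hasDerivAt_Qw_mul_cexp (m : ℕ) (w : ℂ[X]) (b z : ℂ) :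
    HasDerivAt (fun x => Qw m w b x * cexp (b * x)) (Qw (m + 1) w b z * cexp (b * z)) z := by
  have hd : Differentiable ℂ (fun x => w.eval x * cexp (b * x)) := by
    have := w.differentiable (𝕜 := ℂ); fun_prop
  have hfun : (fun x => Qw m w b x * cexp (b * x)) = iteratedDeriv m (fun x => w.eval x * cexp (b * x)) := by
    funext x; rw [iteratedDeriv_eval_mul_cexp]
  rw [hfun, ← iteratedDeriv_eval_mul_cexp, iteratedDeriv_succ]
  have hdm : Differentiable ℂ (iteratedDeriv m (fun x => w.eval x * cexp (b * x))) :=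
    (hd.contDiff (n := ((m + 1 : ℕ) : ℕ∞))).differentiable_iteratedDeriv m
      (by exact_mod_cast Nat.lt_succ_self m)
  exact (hdm z).hasDerivAt

/-- `w^{(μ)}(z) = μ! · ((1/μ!) dᵘ/dzᵘ w)(z)` (formal derivatives vs. Hasse derivatives). [folklore] -/
theorem iterate_derivative_eval_eq_factorial_mul_hasseDeriv (w : ℂ[X]) (μ : ℕ) (z : ℂ) :
    (derivative^[μ] w).eval z = (μ.factorial : ℂ) * (hasseDeriv μ w).eval z := by
  have h := congrFun (factorial_smul_hasseDeriv (R := ℂ) μ) w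
  simp only [LinearMap.smul_apply] at h
  rw [← h, eval_smul, nsmul_eq_mul]

/-- **Size of the Leibniz polynomial**: if `|((1/μ!) dᵘ w)(z)| ≤ W` for all `μ` then
`|Qw m w b z| ≤ m! · W · (1 + |b|)^m`. [cite: BakerTNT1975, Ch. 3 §3 Lemma 5] -/
theorem norm_Qw_le (m : ℕ) (w : ℂ[X]) (b z : ℂ) {W : ℝ}
    (hW : ∀ μ, ‖(hasseDeriv μ w).eval z‖ ≤ W) :
    ‖Qw m w b z‖ ≤ m.factorial * W * (1 + ‖b‖) ^ m := by
  unfold Qw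
  calc ‖∑ μ ∈ range (m + 1), (m.choose μ : ℂ) * (derivative^[μ] w).eval z * b ^ (m - μ)‖
      ≤ ∑ μ ∈ range (m + 1), ‖(m.choose μ : ℂ) * (derivative^[μ] w).eval z * b ^ (m - μ)‖ :=
        norm_sum_le _ _
    _ ≤ ∑ μ ∈ range (m + 1), (m.factorial * W) * ((m.choose μ : ℝ) * ‖b‖ ^ (m - μ)) := by
        refine sum_le_sum fun μ hμ => ?_
        have hμm : μ ≤ m := Nat.lt_succ_iff.mp (mem_range.mp hμ)
        rw [norm_mul, norm_mul, norm_pow, Complex.norm_natCast,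
          iterate_derivative_eval_eq_factorial_mul_hasseDeriv, norm_mul, Complex.norm_natCast]
        have h1 : (μ.factorial : ℝ) ≤ m.factorial := by exact_mod_cast Nat.factorial_le hμm
        have h2 : (μ.factorial : ℝ) * ‖(hasseDeriv μ w).eval z‖ ≤ m.factorial * W :=
          mul_le_mul h1 (hW μ) (norm_nonneg _) (by positivity)
        calc (m.choose μ : ℝ) * ((μ.factorial : ℝ) * ‖(hasseDeriv μ w).eval z‖) * ‖b‖ ^ (m - μ)
            ≤ (m.choose μ : ℝ) * (m.factorial * W) * ‖b‖ ^ (m - μ) := by gcongr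
          _ = (m.factorial * W) * ((m.choose μ : ℝ) * ‖b‖ ^ (m - μ)) := by ring
    _ = m.factorial * W * ∑ μ ∈ range (m + 1), (m.choose μ : ℝ) * ‖b‖ ^ (m - μ) := by
        rw [mul_sum]
    _ = m.factorial * W * (1 + ‖b‖) ^ m := by
        congr 1
        rw [add_pow]
        refine sum_congr rfl fun μ _ => ?_
        rw [one_pow, one_mul, mul_comm]

/-! ### The fixed data -/

/-- **The fixed data of Theorem 3.1** (Baker 1975, Ch. 3 §3, p. 32: "`α₁, …, αₙ` are non-zero
algebraic numbers … the given determinations of the logarithms"): `n + 1` non-zero complex numbers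
`lᵢ` with `e^{lᵢ}` algebraic (the logarithms; the last one is eliminated in (1)), and the bound
`D₀` for the degree of the number fields carrying the coefficients. All the constants `c, c₁, …`
of the source depend on these data only. [cite: BakerTNT1975, Ch. 3 §3] -/
structure Setup where
  /-- the number of logarithms is `n + 1` -/
  n : ℕ
  /-- the logarithms `lᵢ = log αᵢ` (fixed determinations) -/
  l : Fin (n + 1) → ℂ
  /-- the logarithms are non-zero -/
  l_ne_zero : ∀ i, l i ≠ 0
  /-- `αᵢ = e^{lᵢ}` is algebraic -/
  isAlgebraic : ∀ i, IsAlgebraic ℚ (cexp (l i))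
  /-- the bound for the degree of the coefficient fields -/
  D₀ : ℕ

/-- The index set of the unknowns `p(λ₋₁, λ₀, λ₁, …)`: `λ₋₁ < h`, `λ₀ ≤ L` (the `z₀`-polynomial
`Δ(z;λ₋₁)Δ(z;h)^{λ₀}`) and `λ̄ = (λᵢ)_{i ≤ n}` with `λᵢ ≤ L` (the exponents of the `αᵢ`), Baker
1975, p. 32 (`L₋₁ = h - 1`, `L = L₀ = ⋯ = Lₙ`). [cite: BakerTNT1975, Ch. 3 §3 Lemma 4] -/
abbrev Idx (n L h : ℕ) : Type := (Fin h × Fin (L + 1)) × (Fin (n + 1) → Fin (L + 1))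

/-- `#Idx = h (L+1) (L+1)^{n+1}` (Baker's `N = (L₋₁+1)⋯(Lₙ+1)`, p. 33). [cite: BakerTNT1975, Ch. 3 §3 Lemma 4] -/
theorem card_Idx (n L h : ℕ) : Fintype.card (Idx n L h) = h * (L + 1) * (L + 1) ^ (n + 1) := by
  simp [Idx, Fintype.card_prod, Fintype.card_fin]

namespace Setup

variable (S : Setup)

/-- The numbers `αᵢ = e^{lᵢ}`. [cite: BakerTNT1975, Ch. 3 §3] -/
def α (i : Fin (S.n + 1)) : ℂ := cexp (S.l i)

/-- `αᵢ ≠ 0`. [folklore] -/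
theorem α_ne_zero (i : Fin (S.n + 1)) : S.α i ≠ 0 := Complex.exp_ne_zero _

/-- `Λ = 1 + ∑ᵢ |lᵢ|`, a common bound for the logarithms (a constant `c`). [cite: BakerTNT1975, Ch. 3 §3] -/
def Λ : ℝ := 1 + ∑ i, ‖S.l i‖

/-- `1 ≤ Λ`. [folklore] -/
theorem one_le_Λ : 1 ≤ S.Λ := by
  have : 0 ≤ ∑ i, ‖S.l i‖ := by positivity
  unfold Λ; linarith

/-- `|lᵢ| ≤ Λ`. [folklore] -/
theorem norm_l_le (i : Fin (S.n + 1)) : ‖S.l i‖ ≤ S.Λ := by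
  have h : ‖S.l i‖ ≤ ∑ j, ‖S.l j‖ :=
    single_le_sum (f := fun j => ‖S.l j‖) (fun j _ => norm_nonneg _) (mem_univ i)
  unfold Λ; linarith

/-- `∑ᵢ |lᵢ| ≤ Λ`. [folklore] -/
theorem sum_norm_l_le : ∑ i, ‖S.l i‖ ≤ S.Λ := by unfold Λ; linarith

end Setup

/-! ### The varying data: coefficients with bounded denominators and conjugates -/

/-- **The data of one instance of the hypothesis (1)** (Baker 1975, p. 32): a number field `K ⊆ ℂ`
of degree `≤ D₀` containing the `αᵢ`, the coefficients `β₀` (`βv none`) and `β₁, …, βₙ`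
(`βv (some r)`) in `K`, and the size parameter `h ≥ 2` (the source's `h = [log(kB)]`): every `βⱼ`
has a denominator `bⱼ ≤ eʰ` (`bⱼ βⱼ ∈ 𝓞_K`) and all its conjugates are `≤ eʰ` (for `βⱼ` of degree
`≤ d` and height `≤ B` one may take `bⱼ` = the leading coefficient and the bound `B + 1`, with
`eʰ ≥ B + 1`). The small linear form is `Λ' = β₀ + ∑ᵣ βᵣ lᵣ - lₙ` (`Data.Λ'`).
[cite: BakerTNT1975, Ch. 3 §3, eq. (1)] -/
structure Data (S : Setup) where
  /-- the coefficient field -/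
  K : IntermediateField ℚ ℂ
  /-- it is a number field -/
  [fd : FiniteDimensional ℚ K]
  /-- of degree at most `D₀` -/
  finrank_le : Module.finrank ℚ K ≤ S.D₀
  /-- containing the `αᵢ` -/
  αmem : ∀ i, S.α i ∈ K
  /-- the coefficients `β₀` (`none`) and `βᵣ` (`some r`) -/
  βv : Option (Fin S.n) → K
  /-- the size parameter -/
  h : ℕ
  /-- `h ≥ 2` -/
  two_le_h : 2 ≤ h
  /-- denominators of the coefficients -/
  bden : Option (Fin S.n) → ℕ
  /-- the denominators are positive -/
  one_le_bden : ∀ j, 1 ≤ bden j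
  /-- and at most `eʰ` -/
  bden_le : ∀ j, (bden j : ℝ) ≤ Real.exp h
  /-- `bⱼ βⱼ` is an algebraic integer -/
  isIntegral_bden : ∀ j, IsIntegral ℤ ((bden j : K) * βv j)
  /-- all conjugates of the `βⱼ` are at most `eʰ` -/
  norm_emb_le : ∀ (σ : K →+* ℂ) (j : Option (Fin S.n)), ‖σ (βv j)‖ ≤ Real.exp h

namespace Data

variable {S : Setup} (D : Data S) {L : ℕ}

/-- `K` is finite-dimensional over `ℚ` (the structure field, as an instance). [folklore] -/
instance finiteDimensional_K : FiniteDimensional ℚ D.K := D.fd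

/-- `K` is a number field. [folklore] -/
instance numberField_K : NumberField D.K :=
  { to_charZero := charZero_of_injective_algebraMap (algebraMap ℚ D.K).injective
    to_finiteDimensional := D.fd }

/-- `β₀` as a complex number. [cite: BakerTNT1975, Ch. 3 §3] -/
def β₀ : ℂ := (D.βv none : ℂ)

/-- `βᵣ` as a complex number. [cite: BakerTNT1975, Ch. 3 §3] -/
def β (r : Fin S.n) : ℂ := (D.βv (some r) : ℂ)

/-- **The small linear form** `Λ' = β₀ + ∑ᵣ βᵣ lᵣ - lₙ` of hypothesis (1), p. 32.
[cite: BakerTNT1975, Ch. 3 §3, eq. (1)] -/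
def Λ' : ℂ := D.β₀ + ∑ r : Fin S.n, D.β r * S.l (Fin.castSucc r) - S.l (Fin.last S.n)

/-- `1 ≤ h`. [folklore] -/
theorem one_le_h : 1 ≤ D.h := le_trans (by norm_num) D.two_le_h

/-- `1 ≤ eʰ`. [folklore] -/
theorem one_le_exp_h : (1 : ℝ) ≤ Real.exp D.h := Real.one_le_exp (Nat.cast_nonneg _)

/-- The inclusion `K ⊆ ℂ` is one of the embeddings, so `|βⱼ| ≤ eʰ` in `ℂ`. [folklore] -/
theorem norm_βv_le (j : Option (Fin S.n)) : ‖(D.βv j : ℂ)‖ ≤ Real.exp D.h :=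
  D.norm_emb_le (algebraMap D.K ℂ) j

/-- `|β₀| ≤ eʰ`. [folklore] -/
theorem norm_β₀_le : ‖D.β₀‖ ≤ Real.exp D.h := D.norm_βv_le none

/-- `|βᵣ| ≤ eʰ`. [folklore] -/
theorem norm_β_le (r : Fin S.n) : ‖D.β r‖ ≤ Real.exp D.h := D.norm_βv_le (some r)

/-! ### The closed form of the auxiliary function -/

/-- The `z₀`-polynomial of the unknown `u = ((λ₋₁, λ₀), λ̄)`: `w_u = Δ(z; λ₋₁) Δ(z; h)^{λ₀}`.
[cite: BakerTNT1975, Ch. 3 §3 Lemma 4] -/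
def wOf (u : Idx S.n L D.h) : ℂ[X] := wPoly (u.1.1 : ℕ) (u.1.2 : ℕ) D.h

/-- `λₙ β₀`, the coefficient in `e^{λₙ β₀ z₀}` (p. 32). [cite: BakerTNT1975, Ch. 3 §3 Lemma 4] -/
def bq (u : Idx S.n L D.h) : ℂ := ((u.2 (Fin.last S.n) : ℕ) : ℂ) * D.β₀

/-- `γᵣ = λᵣ + λₙ βᵣ` (p. 32). [cite: BakerTNT1975, Ch. 3 §3 Lemma 4] -/
def γ (u : Idx S.n L D.h) (r : Fin S.n) : ℂ :=
  ((u.2 (Fin.castSucc r) : ℕ) : ℂ) + ((u.2 (Fin.last S.n) : ℕ) : ℂ) * D.β r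

/-- `∏ᵣ (γᵣ lᵣ)^{mᵣ}`, the factor produced by `mᵣ` differentiations in `zᵣ`.
[cite: BakerTNT1975, Ch. 3 §3 Lemma 5] -/
def A (u : Idx S.n L D.h) (m : Fin (S.n + 1) → ℕ) : ℂ :=
  ∏ r : Fin S.n, (D.γ u r * S.l (Fin.castSucc r)) ^ m r.succ

/-- `ψ_u = ∑ᵢ λᵢ lᵢ`. [cite: BakerTNT1975, Ch. 3 §4] -/
def ψ (u : Idx S.n L D.h) : ℂ := ∑ i, ((u.2 i : ℕ) : ℂ) * S.l i

/-- The exponent on the diagonal: `λₙ β₀ + ∑ᵣ γᵣ lᵣ = ψ_u + λₙ Λ'` (the second form exhibits the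
small perturbation `λₙ Λ'` of `ψ_u`; Baker substitutes `αₙ' = e^{β₀} α₁^{β₁}⋯` for `αₙ`, p. 33).
[cite: BakerTNT1975, Ch. 3 §3 Lemma 4] -/
def expo (u : Idx S.n L D.h) : ℂ := D.ψ u + ((u.2 (Fin.last S.n) : ℕ) : ℂ) * D.Λ'

/-- **The identity behind the diagonal**: `ψ_u + λₙ Λ' = λₙ β₀ + ∑ᵣ γᵣ lᵣ`. [cite: BakerTNT1975, Ch. 3 §3 Lemma 4] -/
theorem expo_eq (u : Idx S.n L D.h) : D.expo u = D.bq u + ∑ r, D.γ u r * S.l (Fin.castSucc r) := by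
  simp only [expo, ψ, Λ', bq, γ, Fin.sum_univ_castSucc, add_mul, sum_add_distrib, mul_add, mul_sum,
    mul_sub]
  ring_nf

/-- One term of `f(z) = Φ_m(z, …, z)`: `Qw(m₀, w_u, λₙβ₀, z) · ∏ᵣ (γᵣ lᵣ)^{mᵣ} · e^{(ψ_u + λₙΛ') z}`
(the closed form of the diagonal mixed derivative of
`w_u(z₀) e^{λₙβ₀z₀} ∏ᵣ αᵣ^{γᵣ zᵣ}`, Baker 1975, p. 34). [cite: BakerTNT1975, Ch. 3 §3 Lemma 5] -/
def term (u : Idx S.n L D.h) (m : Fin (S.n + 1) → ℕ) (z : ℂ) : ℂ :=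
  Qw (m 0) (D.wOf u) (D.bq u) z * D.A u m * cexp (D.expo u * z)

/-- **The auxiliary function** `f_m(z) = ∑_u p(u) · term` as a function of the integer
coefficients `p` and the multi-index `m`. [cite: BakerTNT1975, Ch. 3 §3 Lemmas 4–5] -/
def F (p : Idx S.n L D.h → ℤ) (m : Fin (S.n + 1) → ℕ) (z : ℂ) : ℂ :=
  ∑ u, (p u : ℂ) * D.term u m z

/-! ### The derivative of `F` -/

/-- `A (m + e₀) = A m`. [folklore] -/
theorem A_bump_zero (u : Idx S.n L D.h) (m : Fin (S.n + 1) → ℕ) : D.A u (bump m 0) = D.A u m := by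
  unfold A
  refine prod_congr rfl fun r _ => ?_
  rw [bump_apply, if_neg (Fin.succ_ne_zero r), add_zero]

/-- `A (m + e_{r+1}) = A m · γᵣ lᵣ`. [folklore] -/
theorem A_bump_succ (u : Idx S.n L D.h) (m : Fin (S.n + 1) → ℕ) (r : Fin S.n) :
    D.A u (bump m r.succ) = D.A u m * (D.γ u r * S.l (Fin.castSucc r)) := by
  unfold A
  have h : ∀ r' : Fin S.n, (D.γ u r' * S.l (Fin.castSucc r')) ^ bump m r.succ r'.succ =
      (D.γ u r' * S.l (Fin.castSucc r')) ^ m r'.succ *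
        (if r' = r then D.γ u r * S.l (Fin.castSucc r) else 1) := by
    intro r'
    rw [bump_apply, pow_add]
    congr 1
    by_cases hr : r' = r
    · subst hr; simp
    · have : r'.succ ≠ r.succ := fun e => hr (Fin.succ_injective _ e)
      rw [if_neg this, if_neg hr, pow_zero]
  simp_rw [h]
  rw [prod_mul_distrib, prod_ite_eq' univ r, if_pos (mem_univ r)]

/-- **The derivative of one term**: `d/dz term_m = term_{m+e₀} + ∑ᵣ term_{m+e_{r+1}}`.
[cite: BakerTNT1975, Ch. 3 §3 Lemma 6, eq. (7)] -/
theorem hasDerivAt_term (u : Idx S.n L D.h) (m : Fin (S.n + 1) → ℕ) (z : ℂ) :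
    HasDerivAt (D.term u m)
      (D.term u (bump m 0) z + ∑ r : Fin S.n, D.term u (bump m r.succ) z) z := by
  set c : ℂ := ∑ r, D.γ u r * S.l (Fin.castSucc r) with hc
  have hexp : ∀ x, cexp (D.expo u * x) = cexp (D.bq u * x) * cexp (c * x) := by
    intro x; rw [← Complex.exp_add, D.expo_eq u, hc]; ring_nf
  have hsplit : D.term u m = fun x => (Qw (m 0) (D.wOf u) (D.bq u) x * cexp (D.bq u * x)) *
      (D.A u m * cexp (c * x)) := by
    funext x; simp only [term, hexp x]; ring
  rw [hsplit]
  have h1 := hasDerivAt_Qw_mul_cexp (m 0) (D.wOf u) (D.bq u) z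
  have h2 : HasDerivAt (fun x => D.A u m * cexp (c * x)) (D.A u m * (cexp (c * z) * c)) z := by
    have : HasDerivAt (fun x => cexp (c * x)) (cexp (c * z) * c) z := by
      have h := ((hasDerivAt_id z).const_mul c).cexp
      simpa using h
    exact this.const_mul _
  refine (h1.fun_mul h2).congr_deriv ?_
  have e0 : D.term u (bump m 0) z = Qw (m 0 + 1) (D.wOf u) (D.bq u) z * cexp (D.bq u * z) *
      (D.A u m * cexp (c * z)) := by
    simp only [term, A_bump_zero, bump_apply, if_true, hexp z]; ring
  have er : ∀ r : Fin S.n, D.term u (bump m r.succ) z =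
      Qw (m 0) (D.wOf u) (D.bq u) z * cexp (D.bq u * z) *
        (D.A u m * cexp (c * z)) * (D.γ u r * S.l (Fin.castSucc r)) := by
    intro r
    simp only [term, A_bump_succ, bump_apply, if_neg (Fin.succ_ne_zero r).symm, add_zero, hexp z]
    ring
  rw [e0]
  simp_rw [er]
  rw [← mul_sum]
  ring

/-- **`d/dz F_m = ∑ᵢ F_{m + eᵢ}`.** [cite: BakerTNT1975, Ch. 3 §3 Lemma 6, eq. (7)] -/
theorem hasDerivAt_F (p : Idx S.n L D.h → ℤ) (m : Fin (S.n + 1) → ℕ) (z : ℂ) :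
    HasDerivAt (D.F p m) (∑ i, D.F p (bump m i) z) z := by
  have h : HasDerivAt (D.F p m) (∑ u, (p u : ℂ) *
      (D.term u (bump m 0) z + ∑ r : Fin S.n, D.term u (bump m r.succ) z)) z := by
    unfold F
    exact HasDerivAt.fun_sum fun u _ => (D.hasDerivAt_term u m z).const_mul _
  refine h.congr_deriv ?_
  rw [Fin.sum_univ_succ]
  simp only [F, mul_add, sum_add_distrib, mul_sum]
  congr 1
  exact sum_comm

/-- `F_m` is entire. [folklore] -/
theorem differentiable_F (p : Idx S.n L D.h → ℤ) (m : Fin (S.n + 1) → ℕ) :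
    Differentiable ℂ (D.F p m) := fun z => (D.hasDerivAt_F p m z).differentiableAt

/-- `deriv F_m = ∑ᵢ F_{m+eᵢ}`. [cite: BakerTNT1975, Ch. 3 §3 Lemma 6] -/
theorem deriv_F (p : Idx S.n L D.h → ℤ) (m : Fin (S.n + 1) → ℕ) :
    deriv (D.F p m) = fun z => ∑ i, D.F p (bump m i) z :=
  funext fun z => (D.hasDerivAt_F p m z).deriv

/-- **Derivatives are controlled by values** (Baker 1975, p. 35, eq. (7): "`|f_m(r)| < n^k B^{-C/2}`
from the inductive hypothesis, as in Lemma 4 of Chapter 2"): if `|F_{m'}(r)| ≤ ε` whenever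
`|m'| ≤ T`, then `|F_m^{(j)}(r)| ≤ (n+1)^j ε` whenever `|m| + j ≤ T`. [cite: BakerTNT1975, Ch. 3 §3 Lemma 6] -/
theorem norm_iteratedDeriv_F_le_of_forall (p : Idx S.n L D.h → ℤ) (r : ℂ) (T : ℕ) {ε : ℝ}
    (hε : ∀ m : Fin (S.n + 1) → ℕ, ∑ i, m i ≤ T → ‖D.F p m r‖ ≤ ε) :
    ∀ (j : ℕ) (m : Fin (S.n + 1) → ℕ), (∑ i, m i) + j ≤ T →
      ‖iteratedDeriv j (D.F p m) r‖ ≤ ((S.n + 1 : ℕ) : ℝ) ^ j * ε := by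
  intro j
  induction j with
  | zero => intro m hm; simpa using hε m (by simpa using hm)
  | succ j ih =>
    intro m hm
    rw [iteratedDeriv_succ', D.deriv_F p m,
      iteratedDeriv_fun_sum fun i _ => ((D.differentiable_F p _).contDiff).contDiffAt]
    calc ‖∑ i, iteratedDeriv j (D.F p (bump m i)) r‖
        ≤ ∑ i, ‖iteratedDeriv j (D.F p (bump m i)) r‖ := norm_sum_le _ _
      _ ≤ ∑ _i : Fin (S.n + 1), ((S.n + 1 : ℕ) : ℝ) ^ j * ε := by
          refine sum_le_sum fun i _ => ih _ ?_
          rw [sum_bump]; omega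
      _ = ((S.n + 1 : ℕ) : ℝ) ^ (j + 1) * ε := by
          rw [sum_const, card_univ, Fintype.card_fin, nsmul_eq_mul, pow_succ]; push_cast; ring

/-! ### Lemma 5, first assertion: the growth of `f` -/

/-- `|Λ'|`-independent part of the exponent: `|ψ_u| ≤ L Λ`. [cite: BakerTNT1975, Ch. 3 §3 Lemma 5] -/
theorem norm_ψ_le (u : Idx S.n L D.h) : ‖D.ψ u‖ ≤ L * S.Λ := by
  unfold ψ
  calc ‖∑ i, ((u.2 i : ℕ) : ℂ) * S.l i‖ ≤ ∑ i, ‖((u.2 i : ℕ) : ℂ) * S.l i‖ := norm_sum_le _ _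
    _ ≤ ∑ i, (L : ℝ) * ‖S.l i‖ := by
        refine sum_le_sum fun i _ => ?_
        rw [norm_mul, Complex.norm_natCast]
        exact mul_le_mul_of_nonneg_right (by exact_mod_cast Nat.lt_succ_iff.mp (u.2 i).isLt)
          (norm_nonneg _)
    _ = L * ∑ i, ‖S.l i‖ := by rw [mul_sum]
    _ ≤ L * S.Λ := mul_le_mul_of_nonneg_left S.sum_norm_l_le (Nat.cast_nonneg _)

/-- `|ψ_u + λₙ Λ'| ≤ L (Λ + 1)` when `|Λ'| ≤ 1`. [cite: BakerTNT1975, Ch. 3 §3 Lemma 5] -/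
theorem norm_expo_le (u : Idx S.n L D.h) (hΛ : ‖D.Λ'‖ ≤ 1) : ‖D.expo u‖ ≤ L * (S.Λ + 1) := by
  unfold expo
  have h1 := D.norm_ψ_le u
  have h2 : ‖((u.2 (Fin.last S.n) : ℕ) : ℂ) * D.Λ'‖ ≤ L := by
    rw [norm_mul, Complex.norm_natCast]
    calc ((u.2 (Fin.last S.n) : ℕ) : ℝ) * ‖D.Λ'‖ ≤ L * 1 :=
          mul_le_mul (by exact_mod_cast Nat.lt_succ_iff.mp (u.2 _).isLt) hΛ (norm_nonneg _)
            (Nat.cast_nonneg _)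
      _ = L := mul_one _
  calc ‖D.ψ u + ((u.2 (Fin.last S.n) : ℕ) : ℂ) * D.Λ'‖ ≤ ‖D.ψ u‖ + ‖((u.2 (Fin.last S.n) : ℕ) : ℂ) * D.Λ'‖ :=
        norm_add_le _ _
    _ ≤ L * S.Λ + L := add_le_add h1 h2
    _ = L * (S.Λ + 1) := by ring

/-- `|λₙ β₀| ≤ L eʰ`. [cite: BakerTNT1975, Ch. 3 §3 Lemma 5] -/
theorem norm_bq_le (u : Idx S.n L D.h) : ‖D.bq u‖ ≤ L * Real.exp D.h := by
  unfold bq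
  rw [norm_mul, Complex.norm_natCast]
  exact mul_le_mul (by exact_mod_cast Nat.lt_succ_iff.mp (u.2 _).isLt) D.norm_β₀_le
    (norm_nonneg _) (Nat.cast_nonneg _)

/-- `|γᵣ| ≤ 2 L eʰ` (p. 33: "`|γᵣ| ≤ e^{2h}`"). [cite: BakerTNT1975, Ch. 3 §3 Lemma 4] -/
theorem norm_γ_le (u : Idx S.n L D.h) (r : Fin S.n) : ‖D.γ u r‖ ≤ 2 * L * Real.exp D.h := by
  unfold γ
  have h1 : ((u.2 (Fin.castSucc r) : ℕ) : ℝ) ≤ L := by exact_mod_cast Nat.lt_succ_iff.mp (u.2 _).isLt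
  have h2 : ((u.2 (Fin.last S.n) : ℕ) : ℝ) ≤ L := by exact_mod_cast Nat.lt_succ_iff.mp (u.2 _).isLt
  have h3 := D.norm_β_le r
  have h4 := D.one_le_exp_h
  have hL : (0 : ℝ) ≤ L := Nat.cast_nonneg _
  calc ‖((u.2 (Fin.castSucc r) : ℕ) : ℂ) + ((u.2 (Fin.last S.n) : ℕ) : ℂ) * D.β r‖
      ≤ ‖((u.2 (Fin.castSucc r) : ℕ) : ℂ)‖ + ‖((u.2 (Fin.last S.n) : ℕ) : ℂ) * D.β r‖ := norm_add_le _ _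
    _ = ((u.2 (Fin.castSucc r) : ℕ) : ℝ) + ((u.2 (Fin.last S.n) : ℕ) : ℝ) * ‖D.β r‖ := by
        rw [norm_mul, Complex.norm_natCast, Complex.norm_natCast]
    _ ≤ L + L * Real.exp D.h := by gcongr
    _ ≤ L * Real.exp D.h + L * Real.exp D.h := by nlinarith
    _ = 2 * L * Real.exp D.h := by ring

/-- `|∏ᵣ (γᵣ lᵣ)^{mᵣ}| ≤ (2 L eʰ Λ)^{∑ mᵣ}`. [cite: BakerTNT1975, Ch. 3 §3 Lemma 5] -/
theorem norm_A_le (u : Idx S.n L D.h) (m : Fin (S.n + 1) → ℕ) :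
    ‖D.A u m‖ ≤ (2 * L * Real.exp D.h * S.Λ) ^ (∑ r : Fin S.n, m r.succ) := by
  unfold A
  rw [norm_prod, ← prod_pow_eq_pow_sum]
  refine prod_le_prod (fun r _ => norm_nonneg _) fun r _ => ?_
  rw [norm_pow]
  refine pow_le_pow_left₀ (norm_nonneg _) ?_ _
  rw [norm_mul]
  exact mul_le_mul (D.norm_γ_le u r) (S.norm_l_le _) (norm_nonneg _) (by positivity)

/-- The uniform bound for the Hasse derivatives of `w_u`:
`|((1/μ!) dᵘ w_u)(z)| ≤ 4^{(⌈|z|⌉ + h)(L+1)}`. [cite: BakerTNT1975, Ch. 3 §3 Lemma 5] -/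
theorem norm_hasseDeriv_wOf_le (u : Idx S.n L D.h) (z : ℂ) (μ : ℕ) :
    ‖(hasseDeriv μ (D.wOf u)).eval z‖ ≤ (4 : ℝ) ^ ((⌈‖z‖⌉₊ + D.h) * (L + 1)) := by
  unfold wOf
  refine (norm_hasseDeriv_wPoly_eval_le (le_of_lt u.1.1.isLt) z μ).trans ?_
  exact pow_le_pow_right₀ (by norm_num) (Nat.mul_le_mul_left _
    (Nat.succ_le_succ (Nat.lt_succ_iff.mp u.1.2.isLt)))

/-- **Size of the Leibniz factor**: `|Qw(m₀, w_u, λₙβ₀, z)| ≤ m₀! 4^{(⌈|z|⌉+h)(L+1)} (1 + L eʰ)^{m₀}`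
(p. 34: "`|q(λ₋₁, λ₀, λₙ, z)| ≤ e^{2hm₀} c₁₇^{L(|z|+h)}`"). [cite: BakerTNT1975, Ch. 3 §3 Lemma 5] -/
theorem norm_Qw_wOf_le (u : Idx S.n L D.h) (m₀ : ℕ) (z : ℂ) :
    ‖Qw m₀ (D.wOf u) (D.bq u) z‖ ≤
      m₀.factorial * (4 : ℝ) ^ ((⌈‖z‖⌉₊ + D.h) * (L + 1)) * (1 + L * Real.exp D.h) ^ m₀ := by
  refine (norm_Qw_le m₀ _ _ z (D.norm_hasseDeriv_wOf_le u z)).trans ?_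
  gcongr
  exact D.norm_bq_le u

/-- **Size of one term**:
`|term| ≤ m₀! 4^{(⌈|z|⌉+h)(L+1)} (1 + L eʰ)^{m₀} (2 L eʰ Λ)^{∑ mᵣ} e^{L(Λ+1)|z|}` when `|Λ'| ≤ 1`.
[cite: BakerTNT1975, Ch. 3 §3 Lemma 5] -/
theorem norm_term_le (u : Idx S.n L D.h) (m : Fin (S.n + 1) → ℕ) (z : ℂ) (hΛ : ‖D.Λ'‖ ≤ 1) :
    ‖D.term u m z‖ ≤ (m 0).factorial * (4 : ℝ) ^ ((⌈‖z‖⌉₊ + D.h) * (L + 1)) *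
      (1 + L * Real.exp D.h) ^ m 0 * (2 * L * Real.exp D.h * S.Λ) ^ (∑ r : Fin S.n, m r.succ) *
      Real.exp (L * (S.Λ + 1) * ‖z‖) := by
  have hE : ‖cexp (D.expo u * z)‖ ≤ Real.exp (L * (S.Λ + 1) * ‖z‖) := by
    rw [Complex.norm_exp]
    refine Real.exp_le_exp.mpr ((Complex.re_le_norm _).trans ?_)
    rw [norm_mul]
    exact mul_le_mul_of_nonneg_right (D.norm_expo_le u hΛ) (norm_nonneg _)
  calc ‖D.term u m z‖ = ‖Qw (m 0) (D.wOf u) (D.bq u) z‖ * ‖D.A u m‖ * ‖cexp (D.expo u * z)‖ := by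
        rw [term, norm_mul, norm_mul]
    _ ≤ ((m 0).factorial * (4 : ℝ) ^ ((⌈‖z‖⌉₊ + D.h) * (L + 1)) * (1 + L * Real.exp D.h) ^ m 0) *
          (2 * L * Real.exp D.h * S.Λ) ^ (∑ r : Fin S.n, m r.succ) *
          Real.exp (L * (S.Λ + 1) * ‖z‖) := by
        have h0 : (0 : ℝ) ≤ 2 * L * Real.exp D.h * S.Λ := by
          have := S.one_le_Λ; positivity
        gcongr
        · exact D.norm_Qw_wOf_le u (m 0) z
        · exact D.norm_A_le u m

/-- **Baker 1975, Ch. 3, Lemma 5, first assertion** (p. 34: "`|f(z)| ≤ c₁₃^{hk + L|z|}`"), in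
closed form: if `|p(u)| ≤ P` for all `u`, `|Λ'| ≤ 1` and `|m| ≤ k`, then
`|F_m(z)| ≤ #Idx · P · k! · 4^{(⌈|z|⌉+h)(L+1)} · (1 + L eʰ)^k · (2 L eʰ Λ)^k · e^{L(Λ+1)|z|}`.
[cite: BakerTNT1975, Ch. 3 §3 Lemma 5] -/
theorem norm_F_le (p : Idx S.n L D.h → ℤ) {P : ℝ} (hP : ∀ u, |(p u : ℝ)| ≤ P)
    (m : Fin (S.n + 1) → ℕ) {k : ℕ} (hm : ∑ i, m i ≤ k) (hL : 1 ≤ L) (z : ℂ) (hΛ : ‖D.Λ'‖ ≤ 1) :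
    ‖D.F p m z‖ ≤ (Fintype.card (Idx S.n L D.h) : ℝ) * P * (k.factorial *
      (4 : ℝ) ^ ((⌈‖z‖⌉₊ + D.h) * (L + 1)) * (1 + L * Real.exp D.h) ^ k *
      (2 * L * Real.exp D.h * S.Λ) ^ k * Real.exp (L * (S.Λ + 1) * ‖z‖)) := by
  have hP0 : 0 ≤ P := by
    have : Nonempty (Idx S.n L D.h) := by
      refine ⟨((⟨0, by have := D.two_le_h; omega⟩, ⟨0, Nat.succ_pos L⟩), fun _ => ⟨0, Nat.succ_pos L⟩)⟩
    exact (abs_nonneg _).trans (hP (Classical.arbitrary _))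
  have hsum : (∑ i, m i) = m 0 + ∑ r : Fin S.n, m r.succ := Fin.sum_univ_succ m
  have hm0 : m 0 ≤ k := by omega
  have hmr : ∑ r : Fin S.n, m r.succ ≤ k := by omega
  have hbase1 : (1 : ℝ) ≤ 1 + L * Real.exp D.h := by
    have := D.one_le_exp_h; nlinarith [(Nat.cast_nonneg L : (0 : ℝ) ≤ L)]
  have hbase2 : (1 : ℝ) ≤ 2 * L * Real.exp D.h * S.Λ := by
    have h1 := D.one_le_exp_h; have h2 := S.one_le_Λ
    have hL1 : (1 : ℝ) ≤ L := by exact_mod_cast hL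
    nlinarith [mul_le_mul hL1 h1 zero_le_one (by positivity), mul_nonneg (Nat.cast_nonneg L) (Real.exp_pos (D.h : ℝ)).le]
  have hterm : ∀ u : Idx S.n L D.h, ‖D.term u m z‖ ≤ k.factorial * (4 : ℝ) ^ ((⌈‖z‖⌉₊ + D.h) * (L + 1)) *
      (1 + L * Real.exp D.h) ^ k * (2 * L * Real.exp D.h * S.Λ) ^ k *
      Real.exp (L * (S.Λ + 1) * ‖z‖) := by
    intro u
    refine (D.norm_term_le u m z hΛ).trans ?_
    have h1 : ((m 0).factorial : ℝ) ≤ k.factorial := by exact_mod_cast Nat.factorial_le hm0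
    have h2 : (1 + L * Real.exp D.h) ^ m 0 ≤ (1 + L * Real.exp D.h) ^ k :=
      pow_le_pow_right₀ hbase1 hm0
    have h3 : (2 * L * Real.exp D.h * S.Λ) ^ (∑ r : Fin S.n, m r.succ) ≤
        (2 * L * Real.exp D.h * S.Λ) ^ k := pow_le_pow_right₀ hbase2 hmr
    gcongr
  unfold F
  calc ‖∑ u, (p u : ℂ) * D.term u m z‖ ≤ ∑ u, ‖(p u : ℂ) * D.term u m z‖ := norm_sum_le _ _
    _ ≤ ∑ _u : Idx S.n L D.h, P * (k.factorial * (4 : ℝ) ^ ((⌈‖z‖⌉₊ + D.h) * (L + 1)) *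
          (1 + L * Real.exp D.h) ^ k * (2 * L * Real.exp D.h * S.Λ) ^ k *
          Real.exp (L * (S.Λ + 1) * ‖z‖)) := by
        refine sum_le_sum fun u _ => ?_
        rw [norm_mul, Complex.norm_intCast]
        exact mul_le_mul (hP u) (hterm u) (norm_nonneg _) hP0
    _ = (Fintype.card (Idx S.n L D.h) : ℝ) * P * (k.factorial *
          (4 : ℝ) ^ ((⌈‖z‖⌉₊ + D.h) * (L + 1)) * (1 + L * Real.exp D.h) ^ k *
          (2 * L * Real.exp D.h * S.Λ) ^ k * Real.exp (L * (S.Λ + 1) * ‖z‖)) := by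
        rw [sum_const, card_univ, nsmul_eq_mul]; ring

end Data

end Literature.NumberTheory.Transcendental.Baker1975.Ch3
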